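import Mathlib
import HarnessLib
import Summits.Ventures.LatticeQCDFlow.Exactness.CabibboMarinariORSweep
import Summits.Ventures.LatticeQCDFlow.Exactness.TransformedKernel
import Literature.MathematicalPhysics.QuantumFieldTheory.LatticeGaugeStaticPotentialProofs

/-!
# Staple sums travel with their links under axis permutations and translations; the engine's over-relaxation and heat-bath hits and sweeps reported through a lattice symmetry are the hits and sweeps along the relabelled schedule

HONEST FRAMING: exact (Metropolis-corrected) sampling algorithms for lattice gauge theory;
figures of merit are autocorrelation/cost numbers at stated couplings and volumes; no
continuum-physics claim.

Venture `LatticeQCDFlow` (cell pub-lqcd), sub-topic `Scoring`, FANOUT row 21 (`su3-base`, arm `E1 = 1HB+4OR`: a Cabibbo–Marinari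
heat-bath sweep and over-relaxation sweeps along a FIXED lexicographic schedule of links).  NEW WORK of the cell over row 16's
`Scoring/WilsonStapleSum` (`stapleUp`, `stapleDown`, `stapleSum`), gen-3's `Exactness/CabibboMarinariORSweep` (`latStaple`, the OR hit
`cmLatOR l e = deterministic (siteUpdateMap l …)`, the sweep `cmORSweep sched = cycle …`), row 7's `Exactness/TransformedKernel`
(`conjKernel κ F` = the kernel reported through `F`, `conjKernel_comp`, `conjKernel_id`) and the Literature's lattice symmetries
(`LatticeGaugeStaticPotentialProofs`: `sitePerm`, `edgePerm`, `configPerm`; `TorusConfigShift`: `torusEdgeShift`, `torusConfigShift`).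
Def-free; nothing is cited as a fact; no number.

## What is proved (torus `(ℤ/L)^d`, any group `G`, any representation `ρ`; §3 for `SU(N)`)

* §1 AXIS PERMUTATIONS: `stapleUp_configPerm`, `stapleDown_configPerm`, **`stapleSum_configPerm`** —
  `R_{x,μ}(configPerm π U) = R_{π⁻¹x, π⁻¹μ}(U)` (the transverse directions are relabelled; no link is reversed).
* §2 TRANSLATIONS: `stapleUp_torusConfigShift`, `stapleDown_torusConfigShift`, **`stapleSum_torusConfigShift`** —
  `R_{x,μ}(T_v U) = R_{x−v,μ}(U)`.
* §3 THE ENGINE'S OR HIT AND SWEEP: `latStaple_configPerm`, `latStaple_torusConfigShift`; `conjKernel_cycle` (reporting a cycle of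
  kernels = the cycle of the reported kernels); **`conjKernel_cmLatOR_configPerm`** — the OR hit at link `l` reported through
  `configPerm π` is the OR hit at `edgePerm π l` (same subgroup frame); **`conjKernel_cmORSweep_configPerm`** — an OR sweep along the
  schedule `sched` reported through `configPerm π` is the OR sweep along the RELABELLED schedule; the translation twins
  `conjKernel_cmLatOR_torusConfigShift`, `conjKernel_cmORSweep_torusConfigShift`.
* §4 THE CABIBBO–MARINARI HEAT BATH (generic links `ι`, relabelling `E : ι ≃ ι`, weight `p` with `p ∘ F_E⁻¹ = p`):
  `latFrameHom_mul_arrowCongr_symm`, **`conjKernel_latHit_arrowCongr`** (the heat-bath hit at `l` reported through `F_E` is the hit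
  at `E l`), `conjKernel_latLink_arrowCongr`, **`conjKernel_latSweep_arrowCongr`** (the heat-bath SWEEP along `links` reported through
  `F_E` is the sweep along `links.map E`).
* §5 ROW 21's E1 COMPOSITE `cmORSweep sched ∘ₖ latSweep e^{−βS_W} frames links` (the kernel of
  `wilson_cmHeatBath_orSweep_uniformlyErgodic`): **`conjKernel_cmHeatBath_orSweep_configPerm`** / **`_torusConfigShift`** — reported
  through an axis permutation / a translation it is the same composite along the relabelled schedules (`gibbsDensity_wilson_…_symm`:
  the Wilson weight is blind to the relabelling, Literature `wilsonAction_configPerm` / `wilsonAction_torusConfigShift`).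
So a fixed lexicographic sweep is NOT itself symmetric (its report is the sweep in the relabelled order, a different ordered product),
which is exactly why row 16's every-step symmetry statements are made for symmetric samplers only; the equilibrium statements are
unaffected.  NOT CLAIMED: commutation of hits on non-adjacent links, any symmetry of a particular schedule, numbers.
-/

noncomputable section

namespace Summit.Ventures.LatticeQCDFlow.Scoring

open MeasureTheory ProbabilityTheory Function
open Literature.MathematicalPhysics.QuantumFieldTheory
open Summit.Ventures.LatticeQCDFlow.Exactness (conjKernel conjKernel_apply conjKernel_comp conjKernel_id cycle cycle_nil cycle_cons
  latStaple cmLatOR cmORSweep siteUpdateMap)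

/-! ## §1 Staples under an axis permutation -/

section Perm

variable {d L N : ℕ} {G : Type*} [Group G] [MeasurableSpace G] (π : Equiv.Perm (Fin d))
  (ρ : G →* Matrix (Fin N) (Fin N) ℂ)

/-- The upper staple of the permuted configuration. -/
theorem stapleUp_configPerm (U : GaugeConfig d L G) (x : Site d L) (μ ν : Fin d) :
    stapleUp (configPerm π U) x μ ν = stapleUp U (sitePerm π.symm x) (π.symm μ) (π.symm ν) := by
  simp only [stapleUp, configPerm_apply, sitePerm_shift]

/-- The lower staple of the permuted configuration. -/
theorem stapleDown_configPerm (U : GaugeConfig d L G) (x : Site d L) (μ ν : Fin d) :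
    stapleDown (configPerm π U) x μ ν = stapleDown U (sitePerm π.symm x) (π.symm μ) (π.symm ν) := by
  -- `sitePerm` commutes with backward steps: `s_σ(x − ν̂) = s_σ x − σν̂` (kept local: the same one-liner exists elsewhere in the tree)
  have hsub : ∀ (σ : Equiv.Perm (Fin d)) (y : Site d L) (ν' : Fin d),
      sitePerm σ (y - Pi.single ν' 1) = sitePerm σ y - Pi.single (σ ν') 1 := fun σ y ν' => by
    rw [sub_eq_add_neg, ← Pi.single_neg, sitePerm_add, sitePerm_single, Pi.single_neg, ← sub_eq_add_neg]
  simp only [stapleDown, configPerm_apply, sitePerm_shift, hsub]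

/-- **`R_{x,μ}(configPerm π U) = R_{π⁻¹x, π⁻¹μ}(U)`**: the staple sum travels with its link under an axis permutation. -/
theorem stapleSum_configPerm (U : GaugeConfig d L G) (x : Site d L) (μ : Fin d) :
    stapleSum ρ (configPerm π U) x μ = stapleSum ρ U (sitePerm π.symm x) (π.symm μ) := by
  rw [stapleSum_def, stapleSum_def]
  simp only [stapleUp_configPerm, stapleDown_configPerm]
  exact Finset.sum_equiv π.symm (fun ν => by simp only [Finset.mem_erase, Finset.mem_univ, and_true, ne_eq,
    EmbeddingLike.apply_eq_iff_eq]) (fun ν _ => rfl)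

end Perm

/-! ## §2 Staples under a translation -/

section Shift

variable {d L N : ℕ} {G : Type*} [Group G] [MeasurableSpace G] (v : Site d L) (ρ : G →* Matrix (Fin N) (Fin N) ℂ)

/-- The upper staple of the translated configuration. -/
theorem stapleUp_torusConfigShift (U : GaugeConfig d L G) (x : Site d L) (μ ν : Fin d) :
    stapleUp (TorusTranslation.torusConfigShift v U) x μ ν = stapleUp U (x - v) μ ν := by
  simp only [stapleUp, TorusTranslation.torusConfigShift_apply, Site.shift, add_sub_right_comm]

/-- The lower staple of the translated configuration. -/
theorem stapleDown_torusConfigShift (U : GaugeConfig d L G) (x : Site d L) (μ ν : Fin d) :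
    stapleDown (TorusTranslation.torusConfigShift v U) x μ ν = stapleDown U (x - v) μ ν := by
  simp only [stapleDown, TorusTranslation.torusConfigShift_apply, Site.shift, add_sub_right_comm, sub_right_comm _ v]

/-- **`R_{x,μ}(T_v U) = R_{x−v,μ}(U)`**: the staple sum travels with its link under a translation. -/
theorem stapleSum_torusConfigShift (U : GaugeConfig d L G) (x : Site d L) (μ : Fin d) :
    stapleSum ρ (TorusTranslation.torusConfigShift v U) x μ = stapleSum ρ U (x - v) μ := by
  rw [stapleSum_def, stapleSum_def]
  simp only [stapleUp_torusConfigShift, stapleDown_torusConfigShift]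

end Shift

/-! ## §3 The engine's over-relaxation hit and sweep reported through a lattice symmetry -/

section Engine

variable {d L N : ℕ} {m : Type*} [Fintype m] [DecidableEq m]

/-- The engine's staple function of `CabibboMarinariORSweep` under an axis permutation. -/
theorem latStaple_configPerm (π : Equiv.Perm (Fin d)) (U : GaugeConfig d L (Matrix.specialUnitaryGroup (Fin N) ℂ)) (l : Edge d L) :
    latStaple (configPerm π U) l = latStaple U (sitePerm π.symm l.1, π.symm l.2) :=
  stapleSum_configPerm π (Exactness.suRep N) U l.1 l.2

/-- The engine's staple function under a translation. -/
theorem latStaple_torusConfigShift (v : Site d L) (U : GaugeConfig d L (Matrix.specialUnitaryGroup (Fin N) ℂ)) (l : Edge d L) :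
    latStaple (TorusTranslation.torusConfigShift v U) l = latStaple U (l.1 - v, l.2) :=
  stapleSum_torusConfigShift v (Exactness.suRep N) U l.1 l.2

omit [Fintype m] [DecidableEq m] in
/-- **Reporting a cycle of kernels through `F` is the cycle of the reported kernels.** -/
theorem conjKernel_cycle {Ω Ω' : Type*} [MeasurableSpace Ω] [MeasurableSpace Ω'] (F : Ω ≃ᵐ Ω') :
    ∀ ks : List (Kernel Ω Ω), conjKernel (cycle ks) F = cycle (ks.map fun κ => conjKernel κ F)
  | [] => by rw [cycle_nil, List.map_nil, cycle_nil, conjKernel_id]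
  | κ :: ks => by rw [cycle_cons, List.map_cons, cycle_cons, conjKernel_comp, conjKernel_cycle F ks]

/-- **Relabelling the links conjugates a link update into the update of the relabelled link.**  For a relabelling `E` of the links
with `F_E W = W ∘ E⁻¹` (`MeasurableEquiv.arrowCongr' E refl`: `configPerm π` for `E = edgePerm π`, `torusConfigShift v` for
`E = torusEdgeShift v`) under which the staple function travels with its link, `F_E ∘ (OR hit at l) ∘ F_E⁻¹ = OR hit at E l`
pointwise. -/
theorem arrowCongr_siteUpdateMap_symm (E : Edge d L ≃ Edge d L) (l : Edge d L) (e : Fin N ≃ Fin 2 ⊕ m)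
    (hst : ∀ V : GaugeConfig d L (Matrix.specialUnitaryGroup (Fin N) ℂ), latStaple (fun e' => V (E e')) l = latStaple V (E l))
    (U : GaugeConfig d L (Matrix.specialUnitaryGroup (Fin N) ℂ)) :
    (MeasurableEquiv.arrowCongr' E (MeasurableEquiv.refl (Matrix.specialUnitaryGroup (Fin N) ℂ)))
        (siteUpdateMap (X := fun _ : Edge d L => Matrix.specialUnitaryGroup (Fin N) ℂ) l
          (fun V g => Exactness.cmOR e (latStaple V l) g)
          ((MeasurableEquiv.arrowCongr' E (MeasurableEquiv.refl (Matrix.specialUnitaryGroup (Fin N) ℂ))).symm U)) =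
      siteUpdateMap (X := fun _ : Edge d L => Matrix.specialUnitaryGroup (Fin N) ℂ) (E l)
        (fun V g => Exactness.cmOR e (latStaple V (E l)) g) U := by
  funext e'
  change (siteUpdateMap (X := fun _ : Edge d L => Matrix.specialUnitaryGroup (Fin N) ℂ) l
      (fun V g => Exactness.cmOR e (latStaple V l) g) (fun e'' => U (E e''))) (E.symm e') = _
  simp only [siteUpdateMap]
  by_cases h : e' = E l
  · subst h
    rw [Equiv.symm_apply_apply, update_self, update_self, hst U]
  · have h' : E.symm e' ≠ l := fun h'' => h (by rw [← h'', Equiv.apply_symm_apply])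
    rw [update_of_ne h', update_of_ne h, Equiv.apply_symm_apply]

variable [NeZero L]

/-- **The OR hit reported through a link relabelling is the OR hit at the relabelled link** (same subgroup frame). -/
theorem conjKernel_cmLatOR_arrowCongr (E : Edge d L ≃ Edge d L) (l : Edge d L) (e : Fin N ≃ Fin 2 ⊕ m)
    (hst : ∀ V : GaugeConfig d L (Matrix.specialUnitaryGroup (Fin N) ℂ), latStaple (fun e' => V (E e')) l = latStaple V (E l)) :
    conjKernel (cmLatOR (d := d) (L := L) l e)
        (MeasurableEquiv.arrowCongr' E (MeasurableEquiv.refl (Matrix.specialUnitaryGroup (Fin N) ℂ))) =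
      cmLatOR (E l) e := by
  refine ProbabilityTheory.Kernel.ext fun U => ?_
  rw [conjKernel_apply]
  simp only [Exactness.cmLatOR, Kernel.deterministic_apply]
  rw [Measure.map_dirac' (MeasurableEquiv.measurable _), arrowCongr_siteUpdateMap_symm E l e hst U]

/-- **A whole OR sweep reported through a link relabelling is the OR sweep along the RELABELLED schedule.** -/
theorem conjKernel_cmORSweep_arrowCongr (E : Edge d L ≃ Edge d L)
    (hst : ∀ (V : GaugeConfig d L (Matrix.specialUnitaryGroup (Fin N) ℂ)) (l : Edge d L),
      latStaple (fun e' => V (E e')) l = latStaple V (E l))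
    (sched : List (Edge d L × (Fin N ≃ Fin 2 ⊕ m))) :
    conjKernel (cmORSweep (d := d) (L := L) sched)
        (MeasurableEquiv.arrowCongr' E (MeasurableEquiv.refl (Matrix.specialUnitaryGroup (Fin N) ℂ))) =
      cmORSweep (sched.map fun p => (E p.1, p.2)) := by
  simp only [Exactness.cmORSweep, conjKernel_cycle, List.map_map]
  congr 1
  refine List.map_congr_left fun p _ => ?_
  simp only [comp_apply]
  exact conjKernel_cmLatOR_arrowCongr E p.1 p.2 (fun V => hst V p.1)

/-- **AXIS PERMUTATIONS**: the OR hit at `l` reported through `configPerm π` is the OR hit at `edgePerm π l`. -/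
theorem conjKernel_cmLatOR_configPerm (π : Equiv.Perm (Fin d)) (l : Edge d L) (e : Fin N ≃ Fin 2 ⊕ m) :
    conjKernel (cmLatOR (d := d) (L := L) l e) (configPerm (G := Matrix.specialUnitaryGroup (Fin N) ℂ) π) =
      cmLatOR (edgePerm π l) e :=
  conjKernel_cmLatOR_arrowCongr (edgePerm π) l e fun V => by
    have h := latStaple_configPerm π.symm V l
    simp only [Equiv.symm_symm] at h
    exact h

/-- **AXIS PERMUTATIONS, SWEEPS**: an OR sweep along `sched` reported through `configPerm π` is the OR sweep along the relabelled
schedule `(edgePerm π l, frame)`. -/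
theorem conjKernel_cmORSweep_configPerm (π : Equiv.Perm (Fin d)) (sched : List (Edge d L × (Fin N ≃ Fin 2 ⊕ m))) :
    conjKernel (cmORSweep (d := d) (L := L) sched) (configPerm (G := Matrix.specialUnitaryGroup (Fin N) ℂ) π) =
      cmORSweep (sched.map fun p => (edgePerm π p.1, p.2)) :=
  conjKernel_cmORSweep_arrowCongr (edgePerm π) (fun V l => by
    have h := latStaple_configPerm π.symm V l
    simp only [Equiv.symm_symm] at h
    exact h) sched

/-- **TRANSLATIONS**: the OR hit at `l` reported through `T_v = torusConfigShift v` is the OR hit at `(l.1 + v, l.2)`. -/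
theorem conjKernel_cmLatOR_torusConfigShift (v : Site d L) (l : Edge d L) (e : Fin N ≃ Fin 2 ⊕ m) :
    conjKernel (cmLatOR (d := d) (L := L) l e)
        (TorusTranslation.torusConfigShift (G := Matrix.specialUnitaryGroup (Fin N) ℂ) v) =
      cmLatOR (l.1 + v, l.2) e :=
  conjKernel_cmLatOR_arrowCongr (TorusTranslation.torusEdgeShift v) l e fun V => by
    have h := latStaple_torusConfigShift (-v) V l
    rw [sub_neg_eq_add] at h
    refine Eq.trans ?_ h
    congr 1
    funext e'
    rw [TorusTranslation.torusConfigShift_apply, TorusTranslation.torusEdgeShift_apply, sub_neg_eq_add]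

/-- **TRANSLATIONS, SWEEPS**: an OR sweep along `sched` reported through `T_v` is the OR sweep along the translated schedule. -/
theorem conjKernel_cmORSweep_torusConfigShift (v : Site d L) (sched : List (Edge d L × (Fin N ≃ Fin 2 ⊕ m))) :
    conjKernel (cmORSweep (d := d) (L := L) sched)
        (TorusTranslation.torusConfigShift (G := Matrix.specialUnitaryGroup (Fin N) ℂ) v) =
      cmORSweep (sched.map fun p => ((p.1.1 + v, p.1.2), p.2)) :=
  conjKernel_cmORSweep_arrowCongr (TorusTranslation.torusEdgeShift v) (fun V l => by
    have h := latStaple_torusConfigShift (-v) V l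
    rw [sub_neg_eq_add] at h
    refine Eq.trans ?_ h
    congr 1
    funext e'
    rw [TorusTranslation.torusConfigShift_apply, TorusTranslation.torusEdgeShift_apply, sub_neg_eq_add]) sched

end Engine

/-! ## §4 The Cabibbo–Marinari heat-bath hit, link update and sweep reported through a link relabelling -/

section HeatBath

open scoped ENNReal

variable {ι : Type*} [DecidableEq ι] {n : Type*} [Fintype n] [DecidableEq n] {m : Type*} [Fintype m] [DecidableEq m]

/-- The relabelling `W ↦ W ∘ E⁻¹` of the links pulls a subgroup element placed at link `l` to the link `E l`:
`φ_{l,e}(h) · (F_E⁻¹ ω) = F_E⁻¹ (φ_{E l,e}(h) · ω)`. -/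
theorem latFrameHom_mul_arrowCongr_symm (E : ι ≃ ι) (l : ι) (e : n ≃ Fin 2 ⊕ m) (h : Matrix.specialUnitaryGroup (Fin 2) ℂ)
    (ω : Exactness.Cfg ι n) :
    Exactness.latFrameHom l e h * (MeasurableEquiv.arrowCongr' E (MeasurableEquiv.refl (Matrix.specialUnitaryGroup n ℂ))).symm ω =
      (MeasurableEquiv.arrowCongr' E (MeasurableEquiv.refl (Matrix.specialUnitaryGroup n ℂ))).symm
        (Exactness.latFrameHom (E l) e h * ω) := by
  funext i
  change Exactness.latFrameHom l e h i * ω (E i) = (Exactness.latFrameHom (E l) e h * ω) (E i)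
  rw [Pi.mul_apply]
  simp only [Exactness.latFrameHom, MonoidHom.coe_comp, comp_apply, Exactness.linkHom_apply, Pi.mulSingle_apply,
    EmbeddingLike.apply_eq_iff_eq]

/-- **The Cabibbo–Marinari heat-bath hit at link `l` reported through a link relabelling that preserves the weight `p` is the hit at
`E l`** (same subgroup frame; `p ∘ F_E⁻¹ = p`, e.g. the Wilson weight under a lattice symmetry). -/
theorem conjKernel_latHit_arrowCongr (E : ι ≃ ι) {p : Exactness.Cfg ι n → ℝ≥0∞} (hp : Measurable p)
    (hpE : ∀ ω : Exactness.Cfg ι n,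
      p ((MeasurableEquiv.arrowCongr' E (MeasurableEquiv.refl (Matrix.specialUnitaryGroup n ℂ))).symm ω) = p ω)
    (l : ι) (e : n ≃ Fin 2 ⊕ m) :
    conjKernel (Exactness.latHit p l e) (MeasurableEquiv.arrowCongr' E (MeasurableEquiv.refl (Matrix.specialUnitaryGroup n ℂ))) =
      Exactness.latHit p (E l) e := by
  have hZ : ∀ ω, Exactness.subgroupNorm Exactness.haarSU2 (Exactness.latFrameHom l e) p
      ((MeasurableEquiv.arrowCongr' E (MeasurableEquiv.refl (Matrix.specialUnitaryGroup n ℂ))).symm ω) =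
      Exactness.subgroupNorm Exactness.haarSU2 (Exactness.latFrameHom (E l) e) p ω := by
    intro ω
    unfold Exactness.subgroupNorm
    refine lintegral_congr fun h => ?_
    rw [latFrameHom_mul_arrowCongr_symm, hpE]
  have hind : ∀ (B : Set (Exactness.Cfg ι n)) (y : Exactness.Cfg ι n),
      (⇑(MeasurableEquiv.arrowCongr' E (MeasurableEquiv.refl (Matrix.specialUnitaryGroup n ℂ))) ⁻¹' B).indicator
          (1 : Exactness.Cfg ι n → ℝ≥0∞)
          ((MeasurableEquiv.arrowCongr' E (MeasurableEquiv.refl (Matrix.specialUnitaryGroup n ℂ))).symm y) =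
        B.indicator 1 y := fun B y => by
    by_cases hy : y ∈ B
    · rw [Set.indicator_of_mem hy, Set.indicator_of_mem (show _ ∈ _ ⁻¹' B by
        rw [Set.mem_preimage, MeasurableEquiv.apply_symm_apply]; exact hy)]
      rfl
    · rw [Set.indicator_of_notMem hy, Set.indicator_of_notMem (show _ ∉ _ ⁻¹' B by
        rw [Set.mem_preimage, MeasurableEquiv.apply_symm_apply]; exact hy)]
  refine ProbabilityTheory.Kernel.ext fun ω => Measure.ext fun B hB => ?_
  rw [Exactness.conjKernel_apply' _ _ _ hB]
  simp only [Exactness.latHit]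
  rw [Exactness.subgroupHaarHeatBath_apply _ _ (Exactness.measurable_latFrameHom l e) hp _
      ((MeasurableEquiv.arrowCongr' E (MeasurableEquiv.refl (Matrix.specialUnitaryGroup n ℂ))).measurable hB),
    Exactness.subgroupHaarHeatBath_apply _ _ (Exactness.measurable_latFrameHom (E l) e) hp _ hB]
  refine lintegral_congr fun h => ?_
  rw [hZ, latFrameHom_mul_arrowCongr_symm, hpE, hind]

/-- **The link update (cycle of hits over the frames) reported through the relabelling is the link update at `E l`.** -/
theorem conjKernel_latLink_arrowCongr (E : ι ≃ ι) {p : Exactness.Cfg ι n → ℝ≥0∞} (hp : Measurable p)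
    (hpE : ∀ ω : Exactness.Cfg ι n,
      p ((MeasurableEquiv.arrowCongr' E (MeasurableEquiv.refl (Matrix.specialUnitaryGroup n ℂ))).symm ω) = p ω)
    (frames : List (n ≃ Fin 2 ⊕ m)) (l : ι) :
    conjKernel (Exactness.latLink p frames l) (MeasurableEquiv.arrowCongr' E (MeasurableEquiv.refl (Matrix.specialUnitaryGroup n ℂ))) =
      Exactness.latLink p frames (E l) := by
  simp only [Exactness.latLink, conjKernel_cycle, List.map_map]
  congr 1
  refine List.map_congr_left fun e _ => ?_
  simp only [comp_apply]
  exact conjKernel_latHit_arrowCongr E hp hpE l e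

/-- **THE HEAT-BATH SWEEP REPORTED THROUGH A WEIGHT-PRESERVING LINK RELABELLING IS THE SWEEP ALONG THE RELABELLED LIST OF LINKS.** -/
theorem conjKernel_latSweep_arrowCongr (E : ι ≃ ι) {p : Exactness.Cfg ι n → ℝ≥0∞} (hp : Measurable p)
    (hpE : ∀ ω : Exactness.Cfg ι n,
      p ((MeasurableEquiv.arrowCongr' E (MeasurableEquiv.refl (Matrix.specialUnitaryGroup n ℂ))).symm ω) = p ω)
    (frames : List (n ≃ Fin 2 ⊕ m)) (links : List ι) :
    conjKernel (Exactness.latSweep p frames links)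
        (MeasurableEquiv.arrowCongr' E (MeasurableEquiv.refl (Matrix.specialUnitaryGroup n ℂ))) =
      Exactness.latSweep p frames (links.map E) := by
  simp only [Exactness.latSweep, conjKernel_cycle, List.map_map]
  congr 1
  refine List.map_congr_left fun l _ => ?_
  simp only [comp_apply]
  exact conjKernel_latLink_arrowCongr E hp hpE frames l

end HeatBath

/-! ## §5 Row 21's E1 composite (`'hb' + n_or × 'or'`) reported through a lattice symmetry of the Wilson weight -/

section Composite

open scoped ENNReal

variable {d L N : ℕ} {m : Type*} [Fintype m] [DecidableEq m] [NeZero L]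

/-- The Wilson weight `e^{−βS_W}` is blind to an axis permutation of its argument (Literature `wilsonAction_configPerm`). -/
theorem gibbsDensity_wilson_configPerm_symm (π : Equiv.Perm (Fin d)) (β : ℝ)
    (ω : GaugeConfig d L (Matrix.specialUnitaryGroup (Fin N) ℂ)) :
    Exactness.gibbsDensity (fun U : GaugeConfig d L (Matrix.specialUnitaryGroup (Fin N) ℂ) => β * wilsonAction (Exactness.suRep N) U)
        ((configPerm (G := Matrix.specialUnitaryGroup (Fin N) ℂ) π).symm ω) =
      Exactness.gibbsDensity (fun U : GaugeConfig d L (Matrix.specialUnitaryGroup (Fin N) ℂ) =>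
        β * wilsonAction (Exactness.suRep N) U) ω := by
  change Exactness.gibbsDensity _ (configPerm π.symm ω) = _
  simp only [Exactness.gibbsDensity, wilsonAction_configPerm (Exactness.suRep N) Exactness.continuous_suRep]

/-- The Wilson weight is blind to a translation of its argument (Literature `wilsonAction_torusConfigShift`). -/
theorem gibbsDensity_wilson_torusConfigShift_symm (v : Site d L) (β : ℝ)
    (ω : GaugeConfig d L (Matrix.specialUnitaryGroup (Fin N) ℂ)) :
    Exactness.gibbsDensity (fun U : GaugeConfig d L (Matrix.specialUnitaryGroup (Fin N) ℂ) => β * wilsonAction (Exactness.suRep N) U)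
        ((TorusTranslation.torusConfigShift (G := Matrix.specialUnitaryGroup (Fin N) ℂ) v).symm ω) =
      Exactness.gibbsDensity (fun U : GaugeConfig d L (Matrix.specialUnitaryGroup (Fin N) ℂ) =>
        β * wilsonAction (Exactness.suRep N) U) ω := by
  have h : (TorusTranslation.torusConfigShift (G := Matrix.specialUnitaryGroup (Fin N) ℂ) v).symm ω =
      TorusTranslation.torusConfigShift (-v) ω := by
    funext e'
    change ω (TorusTranslation.torusEdgeShift v e') = _
    rw [TorusTranslation.torusEdgeShift_apply, TorusTranslation.torusConfigShift_apply, sub_neg_eq_add]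
  rw [h]
  simp only [Exactness.gibbsDensity, wilsonAction_torusConfigShift]

/-- **ROW 21's E1 COMPOSITE REPORTED THROUGH AN AXIS PERMUTATION IS THE SAME COMPOSITE ALONG THE RELABELLED SCHEDULES**: heat-bath
sweep over `links.map (edgePerm π)`, then the OR sweep over `(edgePerm π l, frame)`. -/
theorem conjKernel_cmHeatBath_orSweep_configPerm (π : Equiv.Perm (Fin d)) (β : ℝ) (frames : List (Fin N ≃ Fin 2 ⊕ m))
    (links : List (Edge d L)) (sched : List (Edge d L × (Fin N ≃ Fin 2 ⊕ m))) :
    conjKernel (cmORSweep (d := d) (L := L) sched ∘ₖ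
        Exactness.latSweep (Exactness.gibbsDensity fun U : GaugeConfig d L (Matrix.specialUnitaryGroup (Fin N) ℂ) =>
          β * wilsonAction (Exactness.suRep N) U) frames links)
        (configPerm (G := Matrix.specialUnitaryGroup (Fin N) ℂ) π) =
      cmORSweep (sched.map fun p => (edgePerm π p.1, p.2)) ∘ₖ
        Exactness.latSweep (Exactness.gibbsDensity fun U : GaugeConfig d L (Matrix.specialUnitaryGroup (Fin N) ℂ) =>
          β * wilsonAction (Exactness.suRep N) U) frames (links.map (edgePerm π)) := by
  rw [conjKernel_comp, conjKernel_cmORSweep_configPerm]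
  congr 1
  exact conjKernel_latSweep_arrowCongr (edgePerm π)
    (Exactness.measurable_gibbsDensity (Exactness.continuous_smul_wilsonAction (Exactness.suRep N) Exactness.continuous_suRep β))
    (gibbsDensity_wilson_configPerm_symm π β) frames links

/-- **… AND THROUGH A TRANSLATION**: heat-bath sweep over the translated links, then the OR sweep over the translated schedule. -/
theorem conjKernel_cmHeatBath_orSweep_torusConfigShift (v : Site d L) (β : ℝ) (frames : List (Fin N ≃ Fin 2 ⊕ m))
    (links : List (Edge d L)) (sched : List (Edge d L × (Fin N ≃ Fin 2 ⊕ m))) :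
    conjKernel (cmORSweep (d := d) (L := L) sched ∘ₖ
        Exactness.latSweep (Exactness.gibbsDensity fun U : GaugeConfig d L (Matrix.specialUnitaryGroup (Fin N) ℂ) =>
          β * wilsonAction (Exactness.suRep N) U) frames links)
        (TorusTranslation.torusConfigShift (G := Matrix.specialUnitaryGroup (Fin N) ℂ) v) =
      cmORSweep (sched.map fun p => ((p.1.1 + v, p.1.2), p.2)) ∘ₖ
        Exactness.latSweep (Exactness.gibbsDensity fun U : GaugeConfig d L (Matrix.specialUnitaryGroup (Fin N) ℂ) =>
          β * wilsonAction (Exactness.suRep N) U) frames (links.map (TorusTranslation.torusEdgeShift v)) := by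
  rw [conjKernel_comp, conjKernel_cmORSweep_torusConfigShift]
  congr 1
  exact conjKernel_latSweep_arrowCongr (TorusTranslation.torusEdgeShift v)
    (Exactness.measurable_gibbsDensity (Exactness.continuous_smul_wilsonAction (Exactness.suRep N) Exactness.continuous_suRep β))
    (gibbsDensity_wilson_torusConfigShift_symm v β) frames links

end Composite

end Summit.Ventures.LatticeQCDFlow.Scoring
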